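import Literature.NumberTheory.GaloisRepresentations.LocalWeilDatum
import Literature.NumberTheory.GaloisRepresentations.AbstractClassFieldTheory
import Mathlib.FieldTheory.PrimitiveElement
import Mathlib.RingTheory.Norm.Transitivity
import HarnessLib

/-!
# The Weil datum of a non-archimedean local field, VII: relative Galois theory of a pair `W_F ∩ G_L ≤ W_F ∩ G_K`

For finite separable `K ≤ L ⊆ F̄` over a non-archimedean local field `F`, with Weil subgroups
`U = W_F ∩ G_K ⊇ V = W_F ∩ G_L` (`LocalWeilDatum.fieldSubgroup`), this file provides the dictionary
between Neukirch's abstract objects for the pair `(U, V)` (`AbstractClassFieldTheory.lean`) and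
Mathlib's relative field theory of `L/K`:

* `towerAlgebra hKL : Algebra K L` (from `IntermediateField.inclusion`) with its scalar towers,
  finiteness and separability;
* `le_of_fieldSubgroup_le`: `W_F ∩ G_L ≤ W_F ∩ G_K ⟹ K ≤ L` (density of `W_F ∩ G_L` in `G_L`);
* `relEmbOf`: the `K`-embedding `L → F̄` given by `w ∈ U`; two give the same embedding iff they are
  congruent modulo `V` (`relEmbOf_eq_iff`), every `K`-embedding arises (`exists_relEmbOf_eq`), so
  `U/V ≃ (L →ₐ[K] F̄)` and **`(U : V) = [L : K]`** (`relIndex_fieldSubgroup_eq_finrank`);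
* the **relative norm dictionary** `N_{V|U}(a) = N_{L/K}(a)` for `a ∈ Lˣ` (`coe_norm_fieldSubgroup`).

The Galois-group side (`U/V ≅ Gal(L/K)` when `U` normalises `V`) and the translation of the class
field axiom follow in the sequel.

## References

* J. Neukirch, *Algebraic Number Theory*, Ch. IV §4 (p. 284: `A_K`, `N_{L|K} = ∏_σ`, `G_K/G_L`),
  Ch. V §1. [NeukirchANT1999]
* J. Tate, *Number theoretic background*, Corvallis 1979, (1.4.1) (density of `W_F`). [TateCorvallis1979]
-/

noncomputable section

open Field IsNonarchimedeanLocalField ValuativeRel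
open scoped Pointwise

namespace Literature.NumberTheory.GaloisRepresentations

namespace LocalWeilDatum

open AbstractCFT

section Tower

variable {F : Type*} [Field F]
variable {K L : IntermediateField F (AlgebraicClosure F)}

/-- `L` as a `K`-algebra, for intermediate fields `K ≤ L` of `F̄/F` (through `IntermediateField.inclusion`;
a `def`, to be activated locally with `letI`). [folklore] -/
abbrev towerAlgebra (hKL : K ≤ L) : Algebra K L :=
  (IntermediateField.inclusion hKL).toRingHom.toAlgebra

/-- With `towerAlgebra`, `algebraMap K L` is the inclusion. [folklore] -/
theorem towerAlgebra_algebraMap_apply (hKL : K ≤ L) (k : K) :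
    letI := towerAlgebra hKL
    ((algebraMap K L k : L) : AlgebraicClosure F) = (k : AlgebraicClosure F) :=
  rfl

/-- `F ⊆ K ⊆ L` is a scalar tower. [folklore] -/
theorem towerAlgebra_isScalarTower_bot (hKL : K ≤ L) :
    letI := towerAlgebra hKL
    IsScalarTower F K L :=
  letI := towerAlgebra hKL
  IsScalarTower.of_algebraMap_eq fun _ => rfl

/-- `K ⊆ L ⊆ F̄` is a scalar tower. [folklore] -/
theorem towerAlgebra_isScalarTower_top (hKL : K ≤ L) :
    letI := towerAlgebra hKL
    IsScalarTower K L (AlgebraicClosure F) :=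
  letI := towerAlgebra hKL
  IsScalarTower.of_algebraMap_eq fun _ => rfl

/-- `L/K` is finite when `L/F` is. [folklore] -/
theorem towerAlgebra_finiteDimensional (hKL : K ≤ L) [FiniteDimensional F L] :
    letI := towerAlgebra hKL
    FiniteDimensional K L :=
  letI := towerAlgebra hKL
  haveI := towerAlgebra_isScalarTower_bot hKL
  Module.Finite.of_restrictScalars_finite F K L

/-- `L/K` is separable when `L/F` is. [folklore] -/
theorem towerAlgebra_isSeparable (hKL : K ≤ L) [Algebra.IsSeparable F L] :
    letI := towerAlgebra hKL
    Algebra.IsSeparable K L :=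
  letI := towerAlgebra hKL
  haveI := towerAlgebra_isScalarTower_bot hKL
  Algebra.isSeparable_tower_top_of_isSeparable F K L

end Tower

section Local

variable (F : Type*) [Field F] [ValuativeRel F] [TopologicalSpace F] [IsNonarchimedeanLocalField F]
variable {K L : IntermediateField F (AlgebraicClosure F)}

/-- **`W_F ∩ G_L ≤ W_F ∩ G_K ⟹ K ≤ L`** (`K ⊆ F^sep`, `L/F` finite): an element of `K` is fixed by
`W_F ∩ G_L`, hence by its closure `G_L`, hence lies in `L` by the Galois correspondence on `F^sep`.
[cite: TateCorvallis1979, (1.4.1)] -/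
theorem le_of_fieldSubgroup_le (hKs : K ≤ sepClosure F) (hLs : L ≤ sepClosure F) [FiniteDimensional F L]
    (h : fieldSubgroup F L ≤ fieldSubgroup F K) : K ≤ L := by
  intro x hx
  have hx' : ∀ w ∈ fieldSubgroup F L, WeilGroup.toAbsGalois F w • x = x := fun w hw =>
    (mem_fieldSubgroup_iff F).mp (h hw) x hx
  exact coe_mem_of_forall_galFixing_smul F hLs (x := ⟨x, hKs hx⟩)
    (fun σ hσ => smul_eq_self_of_forall_fieldSubgroup F L hx' hσ)

/-! ### Relative embeddings `L → F̄` over `K` and the cosets `(W_F ∩ G_K) / (W_F ∩ G_L)` -/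

/-- The `K`-embedding `L → F̄` given by `w ∈ W_F ∩ G_K` (restriction of the automorphism `w` of
`F̄`, which fixes `K`). [cite: NeukirchANT1999, Ch. IV §4 (p. 284)] -/
def relEmbOf (hKL : K ≤ L) {w : WeilGroup F} (hw : w ∈ fieldSubgroup F K) :
    letI := towerAlgebra hKL
    L →ₐ[K] AlgebraicClosure F :=
  letI := towerAlgebra hKL
  { toFun := fun x => WeilGroup.toAbsGalois F w • (x : AlgebraicClosure F)
    map_one' := by simp
    map_mul' := fun x y => by simp [smul_mul']
    map_zero' := by simp
    map_add' := fun x y => by simp [smul_add]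
    commutes' := fun k => by
      rw [towerAlgebra_algebraMap_apply]
      exact (mem_fieldSubgroup_iff F).mp hw _ k.2 }

/-- `relEmbOf w x = w • x`. [folklore] -/
theorem relEmbOf_apply (hKL : K ≤ L) {w : WeilGroup F} (hw : w ∈ fieldSubgroup F K) (x : L) :
    letI := towerAlgebra hKL
    relEmbOf F hKL hw x = WeilGroup.toAbsGalois F w • (x : AlgebraicClosure F) :=
  rfl

/-- Two elements of `W_F ∩ G_K` give the same `K`-embedding of `L` iff they are congruent modulo
`W_F ∩ G_L`. [cite: NeukirchANT1999, Ch. IV §4 (p. 284)] -/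
theorem relEmbOf_eq_iff (hKL : K ≤ L) {w w' : WeilGroup F} (hw : w ∈ fieldSubgroup F K)
    (hw' : w' ∈ fieldSubgroup F K) :
    letI := towerAlgebra hKL
    relEmbOf F hKL hw = relEmbOf F hKL hw' ↔ w⁻¹ * w' ∈ fieldSubgroup F L := by
  letI := towerAlgebra hKL
  rw [mem_fieldSubgroup_iff, AlgHom.ext_iff]
  simp only [relEmbOf_apply, map_mul, map_inv, mul_smul, inv_smul_eq_iff]
  exact ⟨fun h x hx => (h ⟨x, hx⟩).symm, fun h x => (h x x.2).symm⟩

/-- **Every `K`-embedding `L → F̄` comes from `W_F ∩ G_K`** (`L/F` finite): extend it to an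
automorphism of `F̄` over `K` and move to the dense `W_F` inside its coset modulo the open `G_L`.
[cite: TateCorvallis1979, (1.4.1)] -/
theorem exists_relEmbOf_eq (hKL : K ≤ L) [FiniteDimensional F L] :
    letI := towerAlgebra hKL
    ∀ ι : L →ₐ[K] AlgebraicClosure F, ∃ (w : WeilGroup F) (hw : w ∈ fieldSubgroup F K),
      relEmbOf F hKL hw = ι := by
  letI := towerAlgebra hKL
  haveI := towerAlgebra_isScalarTower_top hKL
  haveI : Normal K (AlgebraicClosure F) := Normal.tower_top_of_normal F K (AlgebraicClosure F)
  intro ι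
  -- extend `ι` to an automorphism `σ` of `F̄` over `K`
  let φ : AlgebraicClosure F →ₐ[K] AlgebraicClosure F := ι.liftNormal (AlgebraicClosure F)
  have hφ : ∀ x : L, φ x = ι x := fun x => by
    simpa using ι.liftNormal_commutes (AlgebraicClosure F) x
  let σ : AlgebraicClosure F ≃ₐ[K] AlgebraicClosure F :=
    AlgEquiv.ofBijective φ (Algebra.IsAlgebraic.algHom_bijective φ)
  have hσ : ∀ y, σ y = φ y := fun y => rfl
  -- as an element `γ ∈ G_K ≤ Γ_F`
  set γ := (absoluteGaloisGroup.toAlgEquiv F).symm (σ.restrictScalars F) with hγ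
  have hγK : γ ∈ galFixing F K := by
    rw [mem_galFixing_iff]
    intro k hk
    rw [hγ, absoluteGaloisGroup.toAlgEquiv_symm_apply, AlgEquiv.restrictScalars_apply]
    exact σ.commutes ⟨k, hk⟩
  -- move inside `γ G_L` to `W_F`
  have hdense := WeilGroup.denseRange_toAbsGalois_holds F
  obtain ⟨w, hw⟩ := hdense.exists_mem_open ((isOpen_galFixing F L).smul γ)
    ⟨γ, Set.mem_smul_set.mpr ⟨1, (galFixing F L).one_mem, mul_one γ⟩⟩
  obtain ⟨τ, hτ, hwτ⟩ := Set.mem_smul_set.mp hw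
  have hwK : w ∈ fieldSubgroup F K := by
    rw [← toAbsGalois_mem_galFixing_iff, ← hwτ, smul_eq_mul]
    exact (galFixing F K).mul_mem hγK (galFixing_antitone F hKL hτ)
  refine ⟨w, hwK, AlgHom.ext fun x => ?_⟩
  rw [relEmbOf_apply, ← hwτ, smul_eq_mul, mul_smul, (mem_galFixing_iff F).mp hτ _ x.2, hγ,
    absoluteGaloisGroup.toAlgEquiv_symm_apply, AlgEquiv.restrictScalars_apply, hσ]
  exact hφ x

/-- The map `(U/V) → (L →ₐ[K] F̄)` on chosen representatives (`U = W_F ∩ G_K`, `V = W_F ∩ G_L`).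
[folklore] -/
def relEmbOfOut (hKL : K ≤ L)
    (q : fieldSubgroup F K ⧸ (fieldSubgroup F L).subgroupOf (fieldSubgroup F K)) :
    letI := towerAlgebra hKL
    L →ₐ[K] AlgebraicClosure F :=
  relEmbOf F hKL (q.out).2

/-- **`(W_F ∩ G_K)/(W_F ∩ G_L) ≃ (L →ₐ[K] F̄)`**: the map on representatives is bijective.
[cite: NeukirchANT1999, Ch. IV §4 (p. 284)] -/
theorem bijective_relEmbOfOut (hKL : K ≤ L) [FiniteDimensional F L] :
    Function.Bijective (relEmbOfOut F hKL) := by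
  letI := towerAlgebra hKL
  constructor
  · intro q₁ q₂ h
    have h' := (relEmbOf_eq_iff F hKL (q₁.out).2 (q₂.out).2).mp h
    rw [← QuotientGroup.out_eq' q₁, ← QuotientGroup.out_eq' q₂]
    exact QuotientGroup.eq.mpr (by rw [Subgroup.mem_subgroupOf]; exact h')
  · intro ι
    obtain ⟨w, hw, rfl⟩ := exists_relEmbOf_eq F hKL ι
    refine ⟨((⟨w, hw⟩ : fieldSubgroup F K) : _ ⧸ _), ?_⟩
    apply (relEmbOf_eq_iff F hKL _ hw).mpr
    have h := QuotientGroup.eq.mp (QuotientGroup.out_eq'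
      (((⟨w, hw⟩ : fieldSubgroup F K) : fieldSubgroup F K ⧸ (fieldSubgroup F L).subgroupOf (fieldSubgroup F K))))
    rw [Subgroup.mem_subgroupOf] at h
    exact h

/-- **`(W_F ∩ G_K : W_F ∩ G_L) = [L : K]`** for `K ≤ L ⊆ F^sep` finite.
[cite: NeukirchANT1999, Ch. IV §4 (`[L : K] = (G_K : G_L)`)] -/
theorem relIndex_fieldSubgroup_eq_finrank (hKL : K ≤ L) (hLs : L ≤ sepClosure F) [FiniteDimensional F L] :
    letI := towerAlgebra hKL
    (fieldSubgroup F L).relIndex (fieldSubgroup F K) = Module.finrank K L := by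
  classical
  letI := towerAlgebra hKL
  haveI : Algebra.IsSeparable F L := (le_separableClosure_iff F (AlgebraicClosure F) L).mp hLs
  haveI := towerAlgebra_finiteDimensional hKL
  haveI := towerAlgebra_isSeparable hKL
  rw [← AlgHom.card K L (AlgebraicClosure F), ← Nat.card_eq_fintype_card,
    ← Nat.card_eq_of_bijective _ (bijective_relEmbOfOut F hKL)]
  rfl

/-! ### The relative norm dictionary -/

/-- **Neukirch's norm is the relative field norm**: for `K ≤ L ⊆ F^sep` finite and `a ∈ (F^sep)ˣ` with
`a ∈ L`, `N_{V|U}(a) = ∏_{ρ ∈ U/V} ρ a = N_{L/K}(a)` in `F̄` (`U = W_F ∩ G_K`, `V = W_F ∩ G_L`).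
[cite: NeukirchANT1999, Ch. IV §4 (p. 284)] -/
theorem coe_norm_fieldSubgroup (hKL : K ≤ L) (hLs : L ≤ sepClosure F) [FiniteDimensional F L]
    {a : SepUnits F} (ha : ((a : SepClosure F) : AlgebraicClosure F) ∈ L) :
    letI := towerAlgebra hKL
    (((norm (fieldSubgroup F L) (fieldSubgroup F K) a : SepUnits F) : SepClosure F) : AlgebraicClosure F) =
      ((Algebra.norm K (⟨_, ha⟩ : L) : K) : AlgebraicClosure F) := by
  classical
  letI := towerAlgebra hKL
  haveI : Algebra.IsSeparable F L := (le_separableClosure_iff F (AlgebraicClosure F) L).mp hLs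
  haveI := towerAlgebra_finiteDimensional hKL
  haveI := towerAlgebra_isSeparable hKL
  haveI := finiteIndex_fieldSubgroup F L
  letI := Fintype.ofFinite (fieldSubgroup F K ⧸ (fieldSubgroup F L).subgroupOf (fieldSubgroup F K))
  have h := Algebra.norm_eq_prod_embeddings K (AlgebraicClosure F) (⟨_, ha⟩ : L)
  rw [show algebraMap K (AlgebraicClosure F) (Algebra.norm K (⟨_, ha⟩ : L)) =
    ((Algebra.norm K (⟨_, ha⟩ : L) : K) : AlgebraicClosure F) from rfl] at h
  rw [h, AbstractCFT.norm, finprod_eq_prod_of_fintype]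
  -- the coercion `(F^sep)ˣ → F̄` is multiplicative
  let c : SepUnits F →* AlgebraicClosure F :=
    (algebraMap (SepClosure F) (AlgebraicClosure F) : SepClosure F →* AlgebraicClosure F).comp
      (Units.coeHom (SepClosure F))
  have hc : ∀ u : SepUnits F, c u = ((u : SepClosure F) : AlgebraicClosure F) := fun u => rfl
  rw [← hc, map_prod]
  refine Fintype.prod_bijective _ (bijective_relEmbOfOut F hKL) _ _ (fun q => ?_)
  rw [hc, coe_smul]
  rfl

/-! ### The Galois group: `(W_F ∩ G_K)/(W_F ∩ G_L) ≅ Gal(L/K)` when `U` normalises `V` -/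

/-- Elements of `W_F` send `F^sep` into itself. [folklore] -/
theorem smul_mem_sepClosure (w : WeilGroup F) {x : AlgebraicClosure F} (hx : x ∈ sepClosure F) :
    WeilGroup.toAbsGalois F w • x ∈ sepClosure F := by
  have hxs : IsSeparable F x := mem_separableClosure_iff.mp hx
  set σ : AlgebraicClosure F ≃ₐ[F] AlgebraicClosure F :=
    absoluteGaloisGroup.toAlgEquiv F (WeilGroup.toAbsGalois F w)
  exact mem_separableClosure_iff.mpr
    (IsSeparable.map (σ : AlgebraicClosure F →ₐ[F] AlgebraicClosure F) (fun a b h => σ.injective h) hxs)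

/-- **`U` normalising `V` means `w(L) ⊆ L` for `w ∈ U`** (`U = W_F ∩ G_K`, `V = W_F ∩ G_L`, `L ⊆ F^sep`
finite): `w x` is fixed by `V = w V w⁻¹`, hence by `G_L`. [cite: NeukirchANT1999, Ch. IV §4] -/
theorem smul_mem_of_le_normalizer (hLs : L ≤ sepClosure F) [FiniteDimensional F L]
    (hUn : fieldSubgroup F K ≤ Subgroup.normalizer ((fieldSubgroup F L : Subgroup (WeilGroup F)) : Set (WeilGroup F)))
    {w : WeilGroup F} (hw : w ∈ fieldSubgroup F K) {x : AlgebraicClosure F} (hx : x ∈ L) :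
    WeilGroup.toAbsGalois F w • x ∈ L := by
  have hmem : WeilGroup.toAbsGalois F w • x ∈ sepClosure F := smul_mem_sepClosure F w (hLs hx)
  refine coe_mem_of_forall_galFixing_smul F hLs (x := ⟨_, hmem⟩) fun σ hσ => ?_
  refine smul_eq_self_of_forall_fieldSubgroup F L (fun v hv => ?_) hσ
  have hv' : w⁻¹ * v * w ∈ fieldSubgroup F L := by
    have := (Subgroup.mem_normalizer_iff''.mp (hUn hw) v).mp hv
    exact this
  have h1 := (mem_fieldSubgroup_iff F).mp hv' x hx
  rw [map_mul, map_mul, map_inv, mul_smul, mul_smul, inv_smul_eq_iff] at h1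
  exact h1

/-- The `K`-algebra endomorphism of `L` given by `w ∈ U` (when `U` normalises `V`). [folklore] -/
def relEndo (hKL : K ≤ L) (hLs : L ≤ sepClosure F) [FiniteDimensional F L]
    (hUn : fieldSubgroup F K ≤ Subgroup.normalizer ((fieldSubgroup F L : Subgroup (WeilGroup F)) : Set (WeilGroup F)))
    {w : WeilGroup F} (hw : w ∈ fieldSubgroup F K) :
    letI := towerAlgebra hKL
    L →ₐ[K] L :=
  letI := towerAlgebra hKL
  { toFun := fun x => ⟨WeilGroup.toAbsGalois F w • (x : AlgebraicClosure F), smul_mem_of_le_normalizer F hLs hUn hw x.2⟩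
    map_one' := Subtype.ext (by simp)
    map_mul' := fun x y => Subtype.ext (by simp [smul_mul'])
    map_zero' := Subtype.ext (by simp)
    map_add' := fun x y => Subtype.ext (by simp [smul_add])
    commutes' := fun k => Subtype.ext (by
      change WeilGroup.toAbsGalois F w • ((algebraMap K L k : L) : AlgebraicClosure F) =
        ((algebraMap K L k : L) : AlgebraicClosure F)
      rw [towerAlgebra_algebraMap_apply]
      exact (mem_fieldSubgroup_iff F).mp hw _ k.2) }

/-- `relEndo w x = w • x` in `F̄`. [folklore] -/
theorem coe_relEndo_apply (hKL : K ≤ L) (hLs : L ≤ sepClosure F) [FiniteDimensional F L]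
    (hUn : fieldSubgroup F K ≤ Subgroup.normalizer ((fieldSubgroup F L : Subgroup (WeilGroup F)) : Set (WeilGroup F)))
    {w : WeilGroup F} (hw : w ∈ fieldSubgroup F K) (x : L) :
    letI := towerAlgebra hKL
    ((relEndo F hKL hLs hUn hw x : L) : AlgebraicClosure F) = WeilGroup.toAbsGalois F w • (x : AlgebraicClosure F) :=
  rfl

/-- `relEndo w` is bijective (an injective endomorphism of the finite-dimensional `L`). [folklore] -/
theorem bijective_relEndo (hKL : K ≤ L) (hLs : L ≤ sepClosure F) [FiniteDimensional F L]
    (hUn : fieldSubgroup F K ≤ Subgroup.normalizer ((fieldSubgroup F L : Subgroup (WeilGroup F)) : Set (WeilGroup F)))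
    {w : WeilGroup F} (hw : w ∈ fieldSubgroup F K) :
    letI := towerAlgebra hKL
    Function.Bijective (relEndo F hKL hLs hUn hw) := by
  letI := towerAlgebra hKL
  haveI := towerAlgebra_finiteDimensional hKL
  have hinj : Function.Injective (relEndo F hKL hLs hUn hw) := fun x y h => by
    have := congrArg (fun z : L => (z : AlgebraicClosure F)) h
    simp only [coe_relEndo_apply] at this
    exact Subtype.ext (smul_left_cancel _ this)
  refine ⟨hinj, ?_⟩
  have := (LinearMap.injective_iff_surjective (f := (relEndo F hKL hLs hUn hw).toLinearMap)).mp hinj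
  exact this

/-- **Restriction `W_F ∩ G_K → Gal(L/K)`** for `U` normalising `V` (`L ⊆ F^sep` finite), as a
homomorphism on the subgroup `U`. [cite: NeukirchANT1999, Ch. IV §4] -/
def relRestrict (hKL : K ≤ L) (hLs : L ≤ sepClosure F) [FiniteDimensional F L]
    (hUn : fieldSubgroup F K ≤ Subgroup.normalizer ((fieldSubgroup F L : Subgroup (WeilGroup F)) : Set (WeilGroup F))) :
    letI := towerAlgebra hKL
    fieldSubgroup F K →* (L ≃ₐ[K] L) :=
  letI := towerAlgebra hKL
  { toFun := fun w => AlgEquiv.ofBijective (relEndo F hKL hLs hUn w.2) (bijective_relEndo F hKL hLs hUn w.2)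
    map_one' := by
      ext x
      change WeilGroup.toAbsGalois F ((1 : fieldSubgroup F K) : WeilGroup F) • (x : AlgebraicClosure F) = x
      rw [OneMemClass.coe_one, map_one, one_smul]
    map_mul' := fun w w' => by
      ext x
      change WeilGroup.toAbsGalois F ((w * w' : fieldSubgroup F K) : WeilGroup F) • (x : AlgebraicClosure F) =
        WeilGroup.toAbsGalois F (w : WeilGroup F) • WeilGroup.toAbsGalois F (w' : WeilGroup F) • (x : AlgebraicClosure F)
      rw [Subgroup.coe_mul, map_mul, mul_smul] }

/-- `relRestrict w` acts on `x ∈ L` as `w`. [folklore] -/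
theorem coe_relRestrict_apply (hKL : K ≤ L) (hLs : L ≤ sepClosure F) [FiniteDimensional F L]
    (hUn : fieldSubgroup F K ≤ Subgroup.normalizer ((fieldSubgroup F L : Subgroup (WeilGroup F)) : Set (WeilGroup F)))
    (w : fieldSubgroup F K) (x : L) :
    letI := towerAlgebra hKL
    ((relRestrict F hKL hLs hUn w x : L) : AlgebraicClosure F) =
      WeilGroup.toAbsGalois F (w : WeilGroup F) • (x : AlgebraicClosure F) :=
  rfl

/-- The kernel of `U → Gal(L/K)` is `V`. [cite: NeukirchANT1999, Ch. IV §4] -/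
theorem relRestrict_eq_one_iff (hKL : K ≤ L) (hLs : L ≤ sepClosure F) [FiniteDimensional F L]
    (hUn : fieldSubgroup F K ≤ Subgroup.normalizer ((fieldSubgroup F L : Subgroup (WeilGroup F)) : Set (WeilGroup F)))
    (w : fieldSubgroup F K) :
    letI := towerAlgebra hKL
    relRestrict F hKL hLs hUn w = 1 ↔ (w : WeilGroup F) ∈ fieldSubgroup F L := by
  letI := towerAlgebra hKL
  rw [mem_fieldSubgroup_iff]
  constructor
  · intro h x hx
    have := congrArg (fun g : L ≃ₐ[K] L => ((g ⟨x, hx⟩ : L) : AlgebraicClosure F)) h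
    simpa [coe_relRestrict_apply] using this
  · intro h
    ext x
    rw [coe_relRestrict_apply, AlgEquiv.one_apply]
    exact h x x.2

/-- Two elements have the same restriction iff congruent modulo `V`. [folklore] -/
theorem relRestrict_eq_relRestrict_iff (hKL : K ≤ L) (hLs : L ≤ sepClosure F) [FiniteDimensional F L]
    (hUn : fieldSubgroup F K ≤ Subgroup.normalizer ((fieldSubgroup F L : Subgroup (WeilGroup F)) : Set (WeilGroup F)))
    (w w' : fieldSubgroup F K) :
    letI := towerAlgebra hKL
    relRestrict F hKL hLs hUn w = relRestrict F hKL hLs hUn w' ↔ (w : WeilGroup F)⁻¹ * w' ∈ fieldSubgroup F L := by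
  letI := towerAlgebra hKL
  rw [show ((w : WeilGroup F)⁻¹ * w' : WeilGroup F) = ((w⁻¹ * w' : fieldSubgroup F K) : WeilGroup F) from rfl,
    ← relRestrict_eq_one_iff F hKL hLs hUn (w⁻¹ * w'), map_mul, map_inv, inv_mul_eq_one, eq_comm]

/-- **`L/K` is Galois** when `U = W_F ∩ G_K` normalises `V = W_F ∩ G_L` (`K ≤ L ⊆ F^sep` finite):
`U/V` injects into `Aut_K(L)`, which injects into the `[L : K]` embeddings `L → F̄`, and `(U : V) = [L : K]`.
[cite: NeukirchANT1999, Ch. IV §4 (Galois `L|K` ↔ `G_L` normal in `G_K`)] -/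
theorem isGalois_of_le_normalizer (hKL : K ≤ L) (hLs : L ≤ sepClosure F) [FiniteDimensional F L]
    (hUn : fieldSubgroup F K ≤ Subgroup.normalizer ((fieldSubgroup F L : Subgroup (WeilGroup F)) : Set (WeilGroup F))) :
    letI := towerAlgebra hKL
    IsGalois K L ∧ Function.Surjective (relRestrict F hKL hLs hUn) := by
  classical
  letI := towerAlgebra hKL
  haveI : Algebra.IsSeparable F L := (le_separableClosure_iff F (AlgebraicClosure F) L).mp hLs
  haveI := towerAlgebra_finiteDimensional hKL
  haveI := towerAlgebra_isSeparable hKL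
  haveI := towerAlgebra_isScalarTower_top hKL
  haveI := finiteIndex_fieldSubgroup F L
  -- `Aut_K(L) ↪ (L →ₐ[K] F̄)`
  let j : (L ≃ₐ[K] L) → (L →ₐ[K] AlgebraicClosure F) := fun g =>
    (IsScalarTower.toAlgHom K L (AlgebraicClosure F)).comp g
  have hj : Function.Injective j := fun g g' h => by
    ext x
    exact AlgHom.congr_fun h x
  have hcard_le : Nat.card (L ≃ₐ[K] L) ≤ Module.finrank K L := by
    rw [← AlgHom.card K L (AlgebraicClosure F), ← Nat.card_eq_fintype_card]
    exact Nat.card_le_card_of_injective j hj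
  -- `U/V ↪ Aut_K(L)`
  let i : fieldSubgroup F K ⧸ (fieldSubgroup F L).subgroupOf (fieldSubgroup F K) → (L ≃ₐ[K] L) :=
    fun q => relRestrict F hKL hLs hUn q.out
  have hi : Function.Injective i := fun q₁ q₂ h => by
    have h' := (relRestrict_eq_relRestrict_iff F hKL hLs hUn _ _).mp h
    rw [← QuotientGroup.out_eq' q₁, ← QuotientGroup.out_eq' q₂]
    exact QuotientGroup.eq.mpr (by rw [Subgroup.mem_subgroupOf]; exact h')
  have hcardUV : Nat.card (fieldSubgroup F K ⧸ (fieldSubgroup F L).subgroupOf (fieldSubgroup F K)) =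
      Module.finrank K L := relIndex_fieldSubgroup_eq_finrank F hKL hLs
  have hcard_ge : Module.finrank K L ≤ Nat.card (L ≃ₐ[K] L) := by
    rw [← hcardUV]
    exact Nat.card_le_card_of_injective i hi
  have hcard : Nat.card (L ≃ₐ[K] L) = Module.finrank K L := le_antisymm hcard_le hcard_ge
  refine ⟨IsGalois.of_card_aut_eq_finrank K L hcard, ?_⟩
  -- surjectivity by counting
  have hbij : Function.Bijective i := hi.bijective_of_nat_card_le (by rw [hcard, hcardUV])
  intro g
  obtain ⟨q, rfl⟩ := hbij.2 g
  exact ⟨q.out, rfl⟩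

/-- **A cyclic pair gives a cyclic Galois group generated by the restriction of `σ`**: if every
`w ∈ U` is `≡ σ^k (mod V)`, then `Gal(L/K)` is generated by `σ|_L`. [cite: NeukirchANT1999, Ch. IV §6, (6.1)] -/
theorem forall_mem_zpowers_relRestrict (hKL : K ≤ L) (hLs : L ≤ sepClosure F) [FiniteDimensional F L]
    (hUn : fieldSubgroup F K ≤ Subgroup.normalizer ((fieldSubgroup F L : Subgroup (WeilGroup F)) : Set (WeilGroup F)))
    {σ : WeilGroup F} (hσ : σ ∈ fieldSubgroup F K)
    (hgen : ∀ τ ∈ fieldSubgroup F K, ∃ k : ℤ, (σ ^ k)⁻¹ * τ ∈ fieldSubgroup F L) :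
    letI := towerAlgebra hKL
    ∀ g : L ≃ₐ[K] L, g ∈ Subgroup.zpowers (relRestrict F hKL hLs hUn ⟨σ, hσ⟩) := by
  letI := towerAlgebra hKL
  intro g
  obtain ⟨w, rfl⟩ := (isGalois_of_le_normalizer F hKL hLs hUn).2 g
  obtain ⟨k, hk⟩ := hgen w w.2
  refine Subgroup.mem_zpowers_iff.mpr ⟨k, ?_⟩
  rw [← map_zpow, relRestrict_eq_relRestrict_iff]
  simpa using hk

/-! ### The index dictionary `(A_K : N_{L|K} A_L) = (Kˣ : N_{L/K} Lˣ)` -/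

/-- **`A^{W_F ∩ G_K} = Kˣ`** as a multiplicative isomorphism, for `K ⊆ F^sep` finite.
[cite: NeukirchANT1999, Ch. V §1 (`A_K = K^*`)] -/
def unitsEquivFixedBy (hKs : K ≤ sepClosure F) [FiniteDimensional F K] :
    Kˣ ≃* fixedBy (SepUnits F) (fieldSubgroup F K) where
  toFun x := ⟨Units.mk0 ⟨((x : K) : AlgebraicClosure F), hKs (x : K).2⟩
      (fun h => x.ne_zero (Subtype.ext (by simpa using congrArg Subtype.val h))),
    mem_fixedBy_fieldSubgroup_of_mem F (x : K).2⟩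
  invFun a := Units.mk0 ⟨(((a : SepUnits F) : SepClosure F) : AlgebraicClosure F),
      mem_of_mem_fixedBy_fieldSubgroup F hKs a.2⟩
    (fun h => (a : SepUnits F).ne_zero (Subtype.ext (by simpa using congrArg Subtype.val h)))
  left_inv x := Units.ext (Subtype.ext rfl)
  right_inv a := Subtype.ext (Units.ext (Subtype.ext rfl))
  map_mul' x y := Subtype.ext (Units.ext (Subtype.ext rfl))

/-- `unitsEquivFixedBy x` is `x` in `F̄`. [folklore] -/
@[simp]
theorem coe_unitsEquivFixedBy (hKs : K ≤ sepClosure F) [FiniteDimensional F K] (x : Kˣ) :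
    ((((unitsEquivFixedBy F hKs x : fixedBy (SepUnits F) (fieldSubgroup F K)) : SepUnits F) : SepClosure F) :
      AlgebraicClosure F) = ((x : K) : AlgebraicClosure F) :=
  rfl

/-- **The norm group dictionary** (relative): `x ∈ Kˣ` corresponds to an element of `N_{V|U}(A^V)`
iff it is a norm from `Lˣ` (`K ≤ L ⊆ F^sep` finite). [cite: NeukirchANT1999, Ch. IV §4 (p. 284); Ch. V §1] -/
theorem unitsEquivFixedBy_mem_normGroup_iff (hKL : K ≤ L) (hKs : K ≤ sepClosure F) (hLs : L ≤ sepClosure F)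
    [FiniteDimensional F K] [FiniteDimensional F L] (x : Kˣ) :
    letI := towerAlgebra hKL
    ((unitsEquivFixedBy F hKs x : fixedBy (SepUnits F) (fieldSubgroup F K)) : SepUnits F) ∈
        normGroup (fieldSubgroup F L) (fieldSubgroup F K) ↔
      x ∈ (Units.map (Algebra.norm K : L →* K)).range := by
  letI := towerAlgebra hKL
  haveI := finiteIndex_fieldSubgroup F L
  rw [mem_normGroup_iff]
  constructor
  · rintro ⟨b, hb, hbx⟩
    have hbL := mem_of_mem_fixedBy_fieldSubgroup F hLs hb
    have hb0 : (⟨_, hbL⟩ : L) ≠ 0 := fun h =>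
      (Units.ne_zero b) (Subtype.ext (congrArg Subtype.val h :))
    refine ⟨Units.mk0 _ hb0, Units.ext (Subtype.ext ?_)⟩
    rw [Units.coe_map, Units.val_mk0, ← coe_norm_fieldSubgroup F hKL hLs hbL, hbx, coe_unitsEquivFixedBy]
  · rintro ⟨y, rfl⟩
    have hys : ((y : L) : AlgebraicClosure F) ∈ sepClosure F := hLs (y : L).2
    have hy0 : (⟨_, hys⟩ : SepClosure F) ≠ 0 := fun h => y.ne_zero (Subtype.ext (congrArg Subtype.val h :))
    refine ⟨Units.mk0 _ hy0, mem_fixedBy_fieldSubgroup_of_mem F (y : L).2, ?_⟩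
    apply Units.ext; apply Subtype.ext
    rw [coe_norm_fieldSubgroup F hKL hLs (y : L).2, coe_unitsEquivFixedBy, Units.coe_map]
    rfl

/-- **`(A^U : N_{V|U} A^V) = (Kˣ : N_{L/K} Lˣ)`** for `U = W_F ∩ G_K ⊇ V = W_F ∩ G_L`, `K ≤ L ⊆ F^sep` finite.
[cite: NeukirchANT1999, Ch. IV §6 (`#H⁰ = (A_K : N_{L|K} A_L)`)] -/
theorem relIndex_normGroup_fieldSubgroup (hKL : K ≤ L) (hKs : K ≤ sepClosure F) (hLs : L ≤ sepClosure F)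
    [FiniteDimensional F K] [FiniteDimensional F L] :
    letI := towerAlgebra hKL
    (normGroup (fieldSubgroup F L) (fieldSubgroup F K)).relIndex (fixedBy (SepUnits F) (fieldSubgroup F K)) =
      (Units.map (Algebra.norm K : L →* K)).range.index := by
  letI := towerAlgebra hKL
  have hsurj : Function.Surjective (unitsEquivFixedBy F hKs).toMonoidHom := (unitsEquivFixedBy F hKs).surjective
  rw [Subgroup.relIndex, ← Subgroup.index_comap_of_surjective
    ((normGroup (fieldSubgroup F L) (fieldSubgroup F K)).subgroupOf (fixedBy (SepUnits F) (fieldSubgroup F K))) hsurj]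
  congr 1
  ext x
  rw [Subgroup.mem_comap, Subgroup.mem_subgroupOf, MulEquiv.coe_toMonoidHom]
  exact unitsEquivFixedBy_mem_normGroup_iff F hKL hKs hLs x

end Local

/-! ### Hilbert's Theorem 90 for cyclic extensions (universe-polymorphic) -/

section Hilbert90

variable {K L : Type*} [Field K] [Field L] [Algebra K L] [FiniteDimensional K L] [IsGalois K L]

/-- **Hilbert's Theorem 90** (cyclic form): for `L/K` finite Galois with group generated by `g` and
`x ∈ L` of norm `1`, there is `a ≠ 0` with `x · g(a) = a`, i.e. `x = a / g(a)`.  Proof by Artin's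
independence of characters: `a = ∑_{i<n} (x g(x) ⋯ g^{i-1}(x)) g^i(y)` for a suitable `y`.
(Mathlib's `groupCohomology.exists_div_of_norm_eq_one` is the same statement, but only for fields
in `Type`; this proof is universe-polymorphic.)
[cite: NeukirchANT1999, Ch. IV §3, Prop. (3.5) (Hilbert 90)] -/
theorem exists_mul_apply_eq_of_norm_eq_one {g : L ≃ₐ[K] L} (hg : ∀ σ : L ≃ₐ[K] L, σ ∈ Subgroup.zpowers g)
    {x : L} (hx : Algebra.norm K x = 1) : ∃ a : L, a ≠ 0 ∧ x * g a = a := by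
  classical
  have hfin : IsOfFinOrder g := isOfFinOrder_of_finite g
  set n := orderOf g with hn
  have hnpos : 0 < n := hfin.orderOf_pos
  -- `N(x) = ∏_{i<n} gⁱ x = 1`
  have hmem : ∀ σ : L ≃ₐ[K] L, σ ∈ Submonoid.powers g := fun σ =>
    (hfin.mem_powers_iff_mem_zpowers).mpr (hg σ)
  let e : Fin n ≃ (L ≃ₐ[K] L) := (finEquivPowers hfin).trans (Equiv.subtypeUnivEquiv hmem)
  have he : ∀ i : Fin n, e i = g ^ (i : ℕ) := fun i => rfl
  have hprod : ∏ i ∈ Finset.range n, (g ^ i) x = 1 := by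
    have h1 := Algebra.norm_eq_prod_automorphisms K x
    rw [hx, map_one, ← Fintype.prod_equiv e (fun i => (g ^ (i : ℕ)) x) (fun σ => σ x) (fun i => by rw [he]),
      Fin.prod_univ_eq_prod_range (fun i => (g ^ i) x) n] at h1
    exact h1.symm
  -- the coefficients `c i = x g(x) ⋯ g^{i-1}(x)`
  let c : ℕ → L := fun i => ∏ j ∈ Finset.range i, (g ^ j) x
  have hc0 : c 0 = 1 := by simp [c]
  have hcn : c n = 1 := hprod
  have hcsucc : ∀ i, x * g (c i) = c (i + 1) := fun i => by
    simp only [c, map_prod, Finset.prod_range_succ']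
    rw [mul_comm]
    congr 1
    refine Finset.prod_congr rfl fun j _ => ?_
    rw [pow_succ', AlgEquiv.mul_apply]
  -- Artin: the `gⁱ`, `i < n`, are linearly independent over `L`
  have hinj : Function.Injective fun i : Fin n => (((g ^ (i : ℕ) : L ≃ₐ[K] L) : L →ₐ[K] L) : L →* L) := by
    intro i j hij
    have h1 : (g ^ (i : ℕ) : L ≃ₐ[K] L) = g ^ (j : ℕ) := by
      apply AlgEquiv.ext
      intro y
      exact DFunLike.congr_fun hij y
    have h2 := (finEquivPowers hfin).injective (Subtype.ext h1 : finEquivPowers hfin i = finEquivPowers hfin j)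
    exact h2
  have hli := (linearIndependent_monoidHom L L).comp _ hinj
  -- so `∑ c i • gⁱ ≠ 0` as a function: pick `y` with `a = ∑ c i gⁱ(y) ≠ 0`
  have hne : ∑ i : Fin n, c i • ((((g ^ (i : ℕ) : L ≃ₐ[K] L) : L →ₐ[K] L) : L →* L) : L → L) ≠ 0 := by
    intro h0
    have := linearIndependent_iff'.mp hli Finset.univ (fun i => c i) h0 ⟨0, hnpos⟩ (Finset.mem_univ _)
    simp only [hc0] at this
    exact one_ne_zero this
  obtain ⟨y, hy⟩ : ∃ y : L, (∑ i : Fin n, c i • ((((g ^ (i : ℕ) : L ≃ₐ[K] L) : L →ₐ[K] L) : L →* L) : L → L)) y ≠ 0 := by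
    by_contra hall
    exact hne (funext fun y => not_not.mp (not_exists.mp hall y))
  set a := ∑ i ∈ Finset.range n, c i * (g ^ i) y with ha_def
  have hay : (∑ i : Fin n, c i • ((((g ^ (i : ℕ) : L ≃ₐ[K] L) : L →ₐ[K] L) : L →* L) : L → L)) y = a := by
    rw [ha_def, Finset.sum_apply, ← Fin.sum_univ_eq_sum_range (fun i => c i * (g ^ i) y) n]
    refine Finset.sum_congr rfl fun i _ => ?_
    rfl
  refine ⟨a, by rw [← hay]; exact hy, ?_⟩
  -- `x g(a) = ∑ c (i+1) g^{i+1} y = a + c n gⁿ y - c 0 y = a`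
  calc x * g a = ∑ i ∈ Finset.range n, c (i + 1) * (g ^ (i + 1)) y := by
        rw [ha_def, map_sum, Finset.mul_sum]
        refine Finset.sum_congr rfl fun i _ => ?_
        rw [map_mul, ← mul_assoc, hcsucc, pow_succ', AlgEquiv.mul_apply]
    _ = (∑ i ∈ Finset.range (n + 1), c i * (g ^ i) y) - c 0 * (g ^ 0) y := by
        rw [Finset.sum_range_succ' (fun i => c i * (g ^ i) y) n, add_sub_cancel_right]
    _ = a := by
        rw [Finset.sum_range_succ, ← ha_def, hcn, hc0, pow_orderOf_eq_one, pow_zero, one_mul,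
          AlgEquiv.one_apply, add_sub_cancel_right]

end Hilbert90

/-! ### The class field axiom of a local field -/

section ClassFieldAxiom

variable (F : Type*) [Field F] [ValuativeRel F] [TopologicalSpace F] [IsNonarchimedeanLocalField F]

/-- **The class field axiom for local fields, `H⁰` part** (Neukirch Ch. V Thm. (1.1), `i = 0`:
"For a cyclic extension `L|K` of local fields, `#H⁰(G(L|K), L*) = [L : K]`", i.e. the norm index
`(K* : N_{L|K} L*)` equals the degree; proved in the source from `h(G, L*) = [L:K] h(G, U_L)` and
`h(G, U_L) = 1` via a normal basis and the filtration `V^n = 1 + π_K^n M`).  Stated for the finite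
separable subextensions `K ⊆ L` of `F̄` over the non-archimedean local field `F` (themselves local
fields), with `L` a `K`-algebra through the inclusion (`towerAlgebra`); the `i = -1` part
(Hilbert 90) is the theorem `exists_mul_apply_eq_of_norm_eq_one`.
[cite: NeukirchANT1999, Ch. V §1, Thm. (1.1)] -/
def cyclicNormIndexEq : Prop :=
  ∀ (K L : IntermediateField F (AlgebraicClosure F)) [FiniteDimensional F L] (hKL : K ≤ L)
    (_hLs : L ≤ sepClosure F),
    letI := towerAlgebra hKL
    ∀ [IsGalois K L] [IsCyclic (L ≃ₐ[K] L)],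
      (Units.map (Algebra.norm K : L →* K)).range.index = Module.finrank K L

variable {F}

/-- **Neukirch's class field axiom (IV (6.1)) for a local Weil datum from Thm. V (1.1).**  Let `d` be a
Weil datum on `(W_F, (F^sep)ˣ)` whose fields are the Weil subgroups `W_F ∩ G_K` of the finite separable
`K ⊆ F̄` (`LocalWeilDatum.IsFieldSubgroup`).  Then the norm-index statement `cyclicNormIndexEq F`
(V (1.1), `i = 0`) and Hilbert 90 (`i = -1`, proved) give `d.IsClassFieldTheory`: for a cyclic pair
`(U, V, σ)` one has `K ≤ L` Galois with cyclic group generated by `σ|_L` (`isGalois_of_le_normalizer`,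
`forall_mem_zpowers_relRestrict`), `(A^U : N_{V|U} A^V) = (Kˣ : N Lˣ) = [L:K] = (U:V)`
(`relIndex_normGroup_fieldSubgroup`, `relIndex_fieldSubgroup_eq_finrank`), and norm-one elements are
`σ b / b`. [cite: NeukirchANT1999, Ch. V §1, Thm. (1.1); Ch. IV §6, (6.1)] -/
theorem isClassFieldTheory_of_cyclicNormIndexEq {d : WeilDatum (WeilGroup F) (SepUnits F)}
    (hd : ∀ U : Subgroup (WeilGroup F), d.IsField U ↔ IsFieldSubgroup F U)
    (h : cyclicNormIndexEq F) : d.IsClassFieldTheory where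
  relIndex_normGroup := fun {U V σ} hcp => by
    obtain ⟨K, hK, hKs, hUK⟩ := (hd U).mp hcp.isField_left
    obtain ⟨L, hL, hLs, hVL⟩ := (hd V).mp hcp.isField_right
    subst hUK
    subst hVL
    haveI := hK
    haveI := hL
    have hKL : K ≤ L := le_of_fieldSubgroup_le F hKs hLs hcp.le
    letI := towerAlgebra hKL
    haveI := towerAlgebra_finiteDimensional hKL
    obtain ⟨hgal, -⟩ := isGalois_of_le_normalizer F hKL hLs hcp.le_normalizer
    haveI := hgal
    haveI : IsCyclic (L ≃ₐ[K] L) :=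
      ⟨⟨relRestrict F hKL hLs hcp.le_normalizer ⟨σ, hcp.mem⟩, fun τ =>
        Subgroup.mem_zpowers_iff.mp (forall_mem_zpowers_relRestrict F hKL hLs hcp.le_normalizer hcp.mem hcp.gen τ)⟩⟩
    rw [relIndex_normGroup_fieldSubgroup F hKL hKs hLs, h K L hKL hLs,
      ← relIndex_fieldSubgroup_eq_finrank F hKL hLs]
  exists_eq_smul_div := fun {U V σ} hcp a ha h1 => by
    obtain ⟨K, hK, hKs, hUK⟩ := (hd U).mp hcp.isField_left
    obtain ⟨L, hL, hLs, hVL⟩ := (hd V).mp hcp.isField_right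
    subst hUK
    subst hVL
    haveI := hK
    haveI := hL
    have hKL : K ≤ L := le_of_fieldSubgroup_le F hKs hLs hcp.le
    letI := towerAlgebra hKL
    haveI := towerAlgebra_finiteDimensional hKL
    obtain ⟨hgal, -⟩ := isGalois_of_le_normalizer F hKL hLs hcp.le_normalizer
    haveI := hgal
    have hg := forall_mem_zpowers_relRestrict F hKL hLs hcp.le_normalizer hcp.mem hcp.gen
    -- `a ∈ L` has norm `1`
    have haL := mem_of_mem_fixedBy_fieldSubgroup F hLs ha
    have hnorm : Algebra.norm K (⟨_, haL⟩ : L) = 1 := by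
      apply Subtype.ext
      have := congrArg (fun u : SepUnits F => ((u : SepClosure F) : AlgebraicClosure F)) h1
      rw [coe_norm_fieldSubgroup F hKL hLs haL] at this
      simpa using this
    -- Hilbert 90: `a = a₀ / g a₀ = g b / b` with `b = a₀⁻¹`
    obtain ⟨a₀, ha₀, hx⟩ := exists_mul_apply_eq_of_norm_eq_one hg hnorm
    have ha₀s : ((a₀ : L) : AlgebraicClosure F) ∈ sepClosure F := hLs a₀.2
    have ha₀' : (⟨_, ha₀s⟩ : SepClosure F) ≠ 0 := fun h0 => ha₀ (Subtype.ext (congrArg Subtype.val h0 :))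
    set b : SepUnits F := (Units.mk0 _ ha₀')⁻¹ with hb_def
    have hbL : ((b : SepClosure F) : AlgebraicClosure F) ∈ L := by
      rw [hb_def, Units.val_inv_eq_inv_val]
      exact inv_mem a₀.2
    refine ⟨b, mem_fixedBy_fieldSubgroup_of_mem F hbL, ?_⟩
    -- compare in `F̄`
    apply Units.ext; apply Subtype.ext
    have hga₀ : ((relRestrict F hKL hLs hcp.le_normalizer ⟨σ, hcp.mem⟩ a₀ : L) : AlgebraicClosure F) =
        WeilGroup.toAbsGalois F σ • ((a₀ : L) : AlgebraicClosure F) :=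
      coe_relRestrict_apply F hKL hLs hcp.le_normalizer ⟨σ, hcp.mem⟩ a₀
    have hx' : (((a : SepUnits F) : SepClosure F) : AlgebraicClosure F) *
        (WeilGroup.toAbsGalois F σ • ((a₀ : L) : AlgebraicClosure F)) = ((a₀ : L) : AlgebraicClosure F) := by
      have := congrArg (fun z : L => (z : AlgebraicClosure F)) hx
      simpa [hga₀] using this
    have hσa₀ : WeilGroup.toAbsGalois F σ • ((a₀ : L) : AlgebraicClosure F) ≠ 0 := by
      rw [Ne, smul_eq_zero_iff_eq]
      exact fun h0 => ha₀ (Subtype.ext h0)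
    rw [hb_def, Units.val_div_eq_div_val, IntermediateField.coe_div, coe_smul, Units.val_inv_eq_inv_val,
      Units.val_mk0, IntermediateField.coe_inv, smul_inv'', inv_div_inv, eq_div_iff hσa₀]
    exact hx'

end ClassFieldAxiom

end LocalWeilDatum

end Literature.NumberTheory.GaloisRepresentations
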